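import Summits.CriticalPhenomena.PercolationContinuityZ3.Theorems.PercNearOneGluingNoHeavyLowerTailMajorityGluingIsoPtsClassMono
import Summits.CriticalPhenomena.PercolationContinuityZ3.Theorems.PercNearOneGluingNoHeavyLowerTailMajorityGluingIsoPtsLineCore
import Summits.CriticalPhenomena.PercolationContinuityZ3.Theorems.PercNearOneGluingNoHeavyLowerTailMajorityGluingHubRefreshIsoFiveLineStep
import HarnessLib

/-!
# THE LINE STEP of the m-point isolation inequality — deletion–absorption along one class–Steiner pair (lane prim-rate, constants-miner 1, gen 31; CANDIDATES §GEN-16 R126–R130, §GEN-31)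

Support file for the closed crux `NoHeavyLowerTail` (stmt-CriticalPhenomena-4575), majority-gluing line; file 4 of the kernel chain for the
m-point isolation inequality `μ(⊥)^γ ≤ ∏_t μ(Iso_t)` (ISO₃ / ISO₄ of the abstract `(4,3)` programme, CANDIDATES §GEN-16 R130).  Verbatim the
five-class file `…MajorityGluingHubRefreshIsoFiveLineStep` with the class labels in an arbitrary finite type `ι` (`#ι = K + 1`) and a real
exponent `γ` with `K γ ≥ K + 1`, `K γ² − 3 K γ + K + 1 ≥ 0`: for a pair `e = x v` with `x` in class `i₀` and `v` Steiner (all weights `< 1`),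
`μ_{w[e ↦ q]}(E)` is affine in `q` (`IsoFive.real_update_affine`, reused), its end points are the laws with `e` deleted / forced open, the
forced-open end point is the ABSORBED system (`clsIso_insert_iff_update`), the slopes are the pivotal = membership probabilities
(`clsIso_pivot_iff`, `clsBot_pivot_iff`), everything at the end points is positive (`IsoFive.real_pos_of_empty_mem`), and the BHK bound
`cls_sep_clusterMono` at every `q ∈ [0,1)` is exactly the hypothesis `hσ` of the analytic line lemma `IsoPtsLine.iso_line` (sum over the classes
`≠ i₀`, no re-indexing needed).  Result `iso_step`: the inequality for «`e` deleted» and for «`e` deleted, `v` absorbed» imply it for the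
original system.  No definitions, no sorries. [cite: VandenbergHaggstromKahn2005, Thm. 1.3 (p. 6)]
-/

noncomputable section

namespace Summit.CriticalPhenomena.PercolationContinuityZ3.Theorems

namespace HubOnly
namespace Refresh
namespace IsoPts

open MeasureTheory
open Literature.Probability.LatticeModels (prodBernoulli)
open Literature.Probability.Percolation
open Literature.Probability.Percolation.BHK2006
open DecisionTree (ind ind_of_mem ind_of_not_mem ind_nonneg)
open IsoFive (real_eq_real_of_sdiff real_update_zero real_update_one real_update_affine real_pos_of_empty_mem)
open scoped Classical

section LineStep

variable {V : Type} [Fintype V] {ι : Type} [Fintype ι]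

omit [Fintype V] [Fintype ι] in
/-- `∅ ∈ Iso_k`. [folklore] -/
theorem empty_mem_clsIso (c : V → Option ι) (k : ι) : (∅ : BondConfig V) ∈ clsIso c k := by
  intro x y j hx hy hjk hr
  have hxy : x ≠ y := fun h => by rw [h, hy] at hx; exact hjk (Option.some_injective _ hx)
  rw [SimpleGraph.reachable_iff_reflTransGen] at hr
  induction hr with
  | refl => exact hxy rfl
  | tail _ hbc _ => exact absurd ((openGraph_adj _ _ _).1 hbc).1 (Set.notMem_empty _)

omit [Fintype V] [Fintype ι] in
/-- `∅ ∈ ⊥`. [folklore] -/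
theorem empty_mem_clsBot (c : V → Option ι) : (∅ : BondConfig V) ∈ clsBot c :=
  (mem_clsBot_iff_forall_clsIso c).2 fun k => empty_mem_clsIso c k

/-- **THE LINE STEP (deletion–absorption), m classes, exponent `γ`.**  For a pair `e = x v` with `x` in class `i₀`, `v` Steiner and all
weights `< 1`: the isolation inequality `μ(⊥)^γ ≤ ∏_k μ(Iso_k)` for the system with `e` deleted and for the system with `e` deleted and `v`
absorbed into class `i₀` imply it for the original system, provided `#ι = K + 1`, `K γ ≥ K + 1`, `K γ² − 3 K γ + K + 1 ≥ 0`.  Proof: the analytic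
line lemma `IsoPtsLine.iso_line` fed with the BHK bound `cls_sep_clusterMono` at every weight of `e`, through the pivotal identities of
`…IsoPtsClassEvents`. [cite: VandenbergHaggstromKahn2005, Thm. 1.3 (p. 6)] -/
theorem iso_step {K γ : ℝ} (hK : (Fintype.card ι : ℝ) = K + 1) (hγK : K + 1 ≤ K * γ) (hγq : 0 ≤ K * γ ^ 2 - 3 * K * γ + K + 1)
    (w : Sym2 V → unitInterval) (hw : ∀ e, (w e : ℝ) < 1) (c : V → Option ι) (t : ι → V)
    (ht : ∀ k, c (t k) = some k) {x v : V} {i₀ : ι} (hx : c x = some i₀) (hv : c v = none) (hxv : x ≠ v)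
    (h0 : (prodBernoulli (Function.update w s(x, v) 0)).real (clsBot c) ^ γ ≤
      ∏ k, (prodBernoulli (Function.update w s(x, v) 0)).real (clsIso c k))
    (h1 : (prodBernoulli (Function.update w s(x, v) 0)).real (clsBot (Function.update c v (some i₀))) ^ γ ≤
      ∏ k, (prodBernoulli (Function.update w s(x, v) 0)).real (clsIso (Function.update c v (some i₀)) k)) :
    (prodBernoulli w).real (clsBot c) ^ γ ≤ ∏ k, (prodBernoulli w).real (clsIso c k) := by
  set e : Sym2 V := s(x, v) with he
  set w0 := Function.update w e 0 with hw0
  set w1 := Function.update w e 1 with hw1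
  set c' := Function.update c v (some i₀) with hc'
  set μ0 := prodBernoulli w0 with hμ0
  -- the line data
  set A : ℝ := μ0.real (clsBot c) with hA
  set R : Set (BondConfig V) := {ω | ∃ k, k ≠ i₀ ∧ ω ∈ clsRch c k v} with hR
  set B : ℝ := μ0.real (clsBot c ∩ R) with hB
  set a : ι → ℝ := fun k => μ0.real (clsIso c k) with ha
  set b : ι → ℝ := fun k => if k = i₀ then μ0.real (clsIso c i₀ ∩ R) else μ0.real (clsIso c k ∩ clsRch c k v) with hb
  have hw0lt : ∀ f, (w0 f : ℝ) < 1 := fun f => by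
    by_cases hf : f = e
    · rw [hf, hw0, Function.update_self]; norm_num
    · rw [hw0, Function.update_of_ne hf]; exact hw f
  -- endpoint `w1` = absorbed system
  have F2iso : ∀ k, (prodBernoulli w1).real (clsIso c k) = μ0.real (clsIso c' k) := fun k => by
    rw [hw1, real_update_one, hμ0, hw0, real_update_zero]
    congr 1; ext η; exact clsIso_insert_iff_update c hx hv hxv k η
  have F2bot : (prodBernoulli w1).real (clsBot c) = μ0.real (clsBot c') := by
    rw [hw1, real_update_one, hμ0, hw0, real_update_zero]
    congr 1; ext η; exact clsBot_insert_iff_update c hx hv hxv η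
  -- `μ_{w1}(Iso_k) = a_k − b_k`, `μ_{w1}(⊥) = A − B`
  have split : ∀ (E P : Set (BondConfig V)), (∀ η, insert e η ∈ E → η \ {e} ∈ E) →
      (∀ η, (η \ {e} ∈ E ∧ insert e η ∉ E) ↔ (η \ {e} ∈ E ∧ η \ {e} ∈ P)) →
      μ0.real E = μ0.real (E ∩ P) + (prodBernoulli w1).real E := by
    intro E P hmono hpiv
    rw [hμ0, hw0, real_update_zero, real_update_zero, hw1, real_update_one]
    have hset : {η : BondConfig V | η \ {e} ∈ E} = {η | η \ {e} ∈ E ∩ P} ∪ {η | insert e η ∈ E} := by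
      ext η
      simp only [Set.mem_setOf_eq, Set.mem_union, Set.mem_inter_iff]
      constructor
      · intro hE
        by_cases hins : insert e η ∈ E
        · exact Or.inr hins
        · exact Or.inl ((hpiv η).1 ⟨hE, hins⟩)
      · rintro (⟨hE, _⟩ | hins)
        · exact hE
        · exact hmono η hins
    rw [hset]
    refine measureReal_union ?_ MeasurableSet.of_discrete
    rw [Set.disjoint_left]
    rintro η ⟨hE, hP⟩ hins
    exact ((hpiv η).2 ⟨hE, hP⟩).2 hins
  have hmonoIso : ∀ k η, insert e η ∈ clsIso c k → η \ {e} ∈ clsIso c k := fun k η h =>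
    clsIso_anti c (Set.sdiff_subset.trans (Set.subset_insert _ _)) h
  have F1iso : ∀ k, (prodBernoulli w1).real (clsIso c k) = a k - b k := by
    intro k
    by_cases hk : k = i₀
    · subst hk
      have := split (clsIso c k) R (hmonoIso k) (fun η => clsIso_pivot_iff_self c hx hv hxv η)
      simp only [hb, if_true, ha]; linarith
    · have := split (clsIso c k) (clsRch c k v) (hmonoIso k) (fun η => clsIso_pivot_iff c hx hxv hk η)
      simp only [hb, if_neg hk, ha]; linarith
  have F1bot : (prodBernoulli w1).real (clsBot c) = A - B := by
    have := split (clsBot c) R (fun η h => clsBot_anti c (Set.sdiff_subset.trans (Set.subset_insert _ _)) h)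
      (fun η => clsBot_pivot_iff c hx hv hxv η)
    simp only [hB, hA]; linarith
  -- positivity / signs
  have hb0 : ∀ k, 0 ≤ b k := fun k => by simp only [hb]; split_ifs <;> exact measureReal_nonneg
  have hab : ∀ k, b k < a k := fun k => by
    have : 0 < (prodBernoulli w1).real (clsIso c k) := by
      rw [F2iso]; exact real_pos_of_empty_mem w0 hw0lt (empty_mem_clsIso c' k)
    linarith [F1iso k]
  have hB0 : 0 ≤ B := measureReal_nonneg
  have hAB : B < A := by
    have : 0 < (prodBernoulli w1).real (clsBot c) := by
      rw [F2bot]; exact real_pos_of_empty_mem w0 hw0lt (empty_mem_clsBot c')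
    linarith [F1bot]
  -- the BHK bound along the line
  have hσ : ∀ q : ℝ, q ∈ Set.Ico (0 : ℝ) 1 →
      ∑ k ∈ Finset.univ.erase i₀, b k / (a k - q * b k) ≤ B / (A - q * B) := by
    intro q hq
    set qI : unitInterval := ⟨q, hq.1, le_of_lt hq.2⟩ with hqI
    set p := Function.update w e qI with hp
    set μq := prodBernoulli p with hμq
    have hq1 : 0 < 1 - q := by linarith [hq.2]
    have vIso : ∀ k, μq.real (clsIso c k) = a k - q * b k := fun k => by
      rw [hμq, hp, real_update_affine, ← hw0, ← hμ0, ← hw1, F1iso]; simp only [hqI]; ring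
    have vBot : μq.real (clsBot c) = A - q * B := by
      rw [hμq, hp, real_update_affine, ← hw0, ← hμ0, ← hw1, F1bot]; simp only [hqI]; ring
    have vIsoR : ∀ k, k ≠ i₀ → μq.real (clsIso c k ∩ clsRch c k v) = (1 - q) * b k := fun k hk => by
      rw [hμq, hp, real_update_affine, ← hw0, ← hμ0]
      have h1' : (prodBernoulli (Function.update w e 1)).real (clsIso c k ∩ clsRch c k v) = 0 := by
        rw [real_update_one]
        have : {η : BondConfig V | insert e η ∈ clsIso c k ∩ clsRch c k v} = ∅ := by
          ext η
          simp only [Set.mem_setOf_eq, Set.mem_inter_iff, Set.mem_empty_iff_false, iff_false, not_and]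
          exact fun hiso hr => not_clsIso_insert_of_clsRch c hx hxv hk hr hiso
        rw [this, measureReal_empty]
      rw [h1', mul_zero, add_zero]
      simp only [hb, if_neg hk, hqI]
    have vBotR : μq.real (clsBot c ∩ R) = (1 - q) * B := by
      rw [hμq, hp, real_update_affine, ← hw0, ← hμ0]
      have h1' : (prodBernoulli (Function.update w e 1)).real (clsBot c ∩ R) = 0 := by
        rw [real_update_one]
        have : {η : BondConfig V | insert e η ∈ clsBot c ∩ R} = ∅ := by
          ext η
          simp only [Set.mem_setOf_eq, Set.mem_inter_iff, Set.mem_empty_iff_false, iff_false, not_and, hR]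
          rintro hbot ⟨k, hk, hr⟩
          exact not_clsIso_insert_of_clsRch c hx hxv hk hr ((mem_clsBot_iff_forall_clsIso c).1 hbot k)
        rw [this, measureReal_empty]
      rw [h1', mul_zero, add_zero]
    -- disjoint union of the `⊥ ∩ {v ∈ C_k}`, `k ≠ i₀`
    have vSum : ∑ k ∈ Finset.univ.erase i₀, μq.real (clsBot c ∩ clsRch c k v) ≤ μq.real (clsBot c ∩ R) := by
      rw [← measureReal_biUnion_finset (μ := μq) (s := Finset.univ.erase i₀) (f := fun k => clsBot c ∩ clsRch c k v) ?_
        (fun _ _ => MeasurableSet.of_discrete)]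
      · refine measureReal_mono ?_ (measure_ne_top _ _)
        intro ω hω
        simp only [Set.mem_iUnion, Set.mem_inter_iff, exists_prop] at hω
        obtain ⟨k, hk, hbot, hr⟩ := hω
        exact ⟨hbot, k, (Finset.mem_erase.1 hk).1, hr⟩
      · intro k _ j _ hkj
        rw [Function.onFun, Set.disjoint_left]
        rintro ω ⟨hbot, hrk⟩ ⟨_, hrj⟩
        exact not_clsRch_of_clsIso_of_clsRch c hkj ((mem_clsBot_iff_forall_clsIso c).1 hbot _) hrj hrk
    -- termwise BHK
    have hBotPos : 0 < A - q * B := by nlinarith [hAB, hB0, hq.1, hq.2]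
    have hterm : ∀ k ∈ Finset.univ.erase i₀, (1 - q) * (b k / (a k - q * b k)) ≤
        μq.real (clsBot c ∩ clsRch c k v) / (A - q * B) := by
      intro k hk
      have hk' : k ≠ i₀ := (Finset.mem_erase.1 hk).1
      have hIsoPos : 0 < a k - q * b k := by nlinarith [hab k, hb0 k, hq.1, hq.2]
      have key := cls_sep_clusterMono p c t ht k v
      rw [← hμq, vBot, vIsoR k hk', vIso k] at key
      rw [mul_div_assoc', div_le_div_iff₀ hIsoPos hBotPos]
      nlinarith [key]
    have hsum := Finset.sum_le_sum hterm
    rw [← Finset.mul_sum, ← Finset.sum_div] at hsum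
    have h2 : (∑ k ∈ Finset.univ.erase i₀, μq.real (clsBot c ∩ clsRch c k v)) / (A - q * B) ≤ (1 - q) * (B / (A - q * B)) := by
      rw [mul_div_assoc', div_le_div_iff_of_pos_right hBotPos, ← vBotR]
      exact vSum
    exact le_of_mul_le_mul_left (hsum.trans h2) hq1
  -- the analytic line lemma at the actual weight of `e`
  have hline := IsoPtsLine.iso_line (a := a) (b := b) (A := A) (B := B) (γ := γ) hK i₀ hγK hγq
    hb0 hab hB0 hAB hσ ?_ ?_ (w := (w e : ℝ)) ⟨(w e).2.1, (w e).2.2⟩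
  · -- read the conclusion at `q = w e`: the original system
    have vIso : ∀ k, (prodBernoulli w).real (clsIso c k) = a k - (w e : ℝ) * b k := fun k => by
      conv_lhs => rw [show w = Function.update w e (w e) from (Function.update_eq_self e w).symm]
      rw [real_update_affine, ← hw0, ← hμ0, ← hw1, F1iso]; ring
    have vBot : (prodBernoulli w).real (clsBot c) = A - (w e : ℝ) * B := by
      conv_lhs => rw [show w = Function.update w e (w e) from (Function.update_eq_self e w).symm]
      rw [real_update_affine, ← hw0, ← hμ0, ← hw1, F1bot]; ring
    rw [vBot, Finset.prod_congr rfl fun k _ => vIso k]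
    exact hline
  · -- end point `q = 0`: the system with `e` deleted
    simpa only [ha, hA] using h0
  · -- end point `q = 1`: the absorbed system
    have : (∏ k, (a k - b k)) = ∏ k, μ0.real (clsIso c' k) := Finset.prod_congr rfl fun k _ => by rw [← F1iso, F2iso]
    rw [this, ← F1bot, F2bot]
    exact h1

end LineStep

end IsoPts
end Refresh
end HubOnly
end Summit.CriticalPhenomena.PercolationContinuityZ3.Theorems
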